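import Mathlib
import Summits.MatrixMultiplication.MatrixMultiplication.Theses.FourierTwoFamiliesModP
import Literature.Computability.AlgebraicComplexity.SimultaneousDoubleProduct

/-!
# `PrimeTwoFamilies` implies the clustered two-families leaf — stub
`stub_clusteredOfPrimeTwoFamilies` of line `registered` (crux
`EisensteinValCertificates.HomocyclicSTPPDesigns`, stmt-MatrixMultiplication-10647)

Calibration stub of the clustered-charts reshape of the line: the OLD open leaf
`FourierTwoFamiliesModP.PrimeTwoFamilies` (stmt-MatrixMultiplication-14308 = CKSU Conj. 4.7 with
prime cyclic hosts: for every `δ > 0` and arbitrarily large `n`, a prime `p ≤ n^{2+δ}` and `n` SDPP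
pairs `(A_i, B_i)` in `ℤ/p` with `|A_i||B_i| ≥ n^{2-δ}`) implies the NEW open leaf
`stub_clusteredTwoFamilies` (clustered SDPP families with uniform sizes and merit
`m · d^{2/3} · (ab)^{(2+ε)/3} > p`), with ONE class: `m = 1`, `cls := fun _ => 0`, `d :=` the
number of pairs kept.  `PrimeTwoFamilies` is taken as a HYPOTHESIS (it is open); nothing here
proves it.

Proof.  Given `ε > 0` put `ε₁ := min ε 1`, `δ := ε₁ / 8`, and take the SDPP family of the
hypothesis at `δ` with `n` large.  UNIFORMISE (`clusteredOfPrime_uniformise`): pigeonhole the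
indices by the dyadic scale `⌊log₂ |A_i|⌋ < K := ⌊log₂ p⌋ + 1` (`|A_i| ≤ p`), keeping a fibre `I`
with `K · |I| ≥ n` on which `a := 2^{s₀} ≤ |A_i| < 2a`; with `b := min_{i ∈ I} |B_i|` one gets
`2ab > |A_{i₀}||B_{i₀}| ≥ n^{2-δ}`; shrink every `A_i` to `a` elements and every `B_i` to `b`
elements (`Finset.exists_subset_card_eq`, `IsSDPP.mono`) and reindex along `Fin |I| ↪ Fin n`
(`IsSDPP.reindex`).  COUNT (`clusteredOfPrime_logBound`): `K ≤ 6 n^{δ/2} / (δ log 2) + 1 ≤ n^δ`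
for `n` large (`Real.log_le_rpow_div`), so `|I| ≥ n^{1-δ}`, and then
`|I|^{2/3} (ab)^{(2+ε)/3} ≥ n^{(1-δ)2/3} (n^{2-δ}/2)^{(2+ε₁)/3} ≥ n^{2+δ+δ/2} / 2 > n^{2+δ} ≥ p`
because `(1-δ)·2/3 + (2-δ)(2+ε₁)/3 ≥ 2 + δ + δ/2` for `δ = ε₁/8 ≤ 1/8` and `n^{δ/2} ≥ 3`.

Sources: H. Cohn, R. Kleinberg, B. Szegedy, C. Umans, *Group-theoretic algorithms for matrix
multiplication*, FOCS 2005 = arXiv:math/0511460, §4 Def. 4.1 (SDPP), Prop. 4.6, Conj. 4.7.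
Not here: `PrimeTwoFamilies` itself (open item stmt-MatrixMultiplication-14308), the leaf
`stub_clusteredTwoFamilies` unconditionally, or any of the other stubs of the line.
-/

set_option linter.dupNamespace false
-- (single-conjunct summit: the namespace repeats `MatrixMultiplication`)

namespace Summit.MatrixMultiplication.MatrixMultiplication.Theorems.HomocyclicSTPPDesigns.ClusteredCharts

open Summit.MatrixMultiplication.MatrixMultiplication.Theses.FourierTwoFamiliesModP (PrimeTwoFamilies)
open Literature.Computability.AlgebraicComplexity Finset
open scoped Pointwise

/-- **Uniformising an SDPP family (dyadic pigeonhole).**  If `n ≥ 1` pairs `(A_i, B_i)` in a finite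
abelian group `H` have the SDPP and `Y ≤ |A_i||B_i|` for all `i` (`Y > 0`), then for some `n'`
with `n / (⌊log₂ |H|⌋ + 1) ≤ n'` there is an SDPP family of `n'` pairs with uniform sizes
`|A'_j| = a`, `|B'_j| = b` and `Y ≤ 2ab`: pigeonhole the indices by `⌊log₂ |A_i|⌋ ≤ ⌊log₂ |H|⌋`,
put `a := 2^{s₀}` on the largest fibre `I` (so `a ≤ |A_i| < 2a` there) and `b := min_{I} |B_i|`,
shrink the sets (`IsSDPP.mono`) and reindex along `Fin |I| ↪ Fin n` (`IsSDPP.reindex`).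
[folklore] -/
theorem clusteredOfPrime_uniformise {H : Type*} [AddCommGroup H] [Fintype H] {n : ℕ}
    (hn : 0 < n) {A B : Fin n → Finset H} (hS : IsSDPP A B) {Y : ℝ} (hY : 0 < Y)
    (hAB : ∀ i, Y ≤ (((A i).card * (B i).card : ℕ) : ℝ)) :
    ∃ (n' a b : ℕ) (A' B' : Fin n' → Finset H), IsSDPP A' B' ∧
      (∀ j, (A' j).card = a ∧ (B' j).card = b) ∧ Y ≤ 2 * ((a * b : ℕ) : ℝ) ∧
      (n : ℝ) / ((Nat.log 2 (Fintype.card H) + 1 : ℕ) : ℝ) ≤ n' := by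
  -- the dyadic scale of `|A i|`, with values `< K`
  obtain ⟨K, hK⟩ : ∃ K : ℕ, K = Nat.log 2 (Fintype.card H) + 1 := ⟨_, rfl⟩
  obtain ⟨s, hs⟩ : ∃ s : Fin n → ℕ, ∀ i, s i = Nat.log 2 (A i).card := ⟨_, fun _ => rfl⟩
  have hsK : ∀ i ∈ (univ : Finset (Fin n)), s i ∈ range K := fun i _ => by
    rw [mem_range, hK, Nat.lt_add_one_iff, hs]
    exact Nat.log_mono_right (card_le_univ (A i))
  have hK0 : K ≠ 0 := by omega
  have hKpos : (0 : ℝ) < K := by exact_mod_cast Nat.pos_of_ne_zero hK0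
  -- pigeonhole: a fibre `I` with `n / K ≤ |I|`
  obtain ⟨s₀, -, hI⟩ := exists_le_card_fiber_of_nsmul_le_card_of_maps_to hsK
    (nonempty_range_iff.2 hK0)
    (show (range K).card • ((n : ℝ) / K) ≤ ((univ : Finset (Fin n)).card : ℝ) by
      rw [card_range, card_univ, Fintype.card_fin, nsmul_eq_mul, mul_div_assoc',
        mul_div_cancel_left₀ _ hKpos.ne'])
  set I : Finset (Fin n) := univ.filter (fun i => s i = s₀) with hIdef
  have hIne : I.Nonempty := by
    rw [← card_pos, ← Nat.cast_pos (α := ℝ)]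
    exact lt_of_lt_of_le (div_pos (by exact_mod_cast hn) hKpos) hI
  have hmemI : ∀ i ∈ I, s i = s₀ := fun i hi => (mem_filter.1 hi).2
  -- every `A i` is non-empty
  have hA0 : ∀ i, (A i).card ≠ 0 := by
    intro i h0
    have h := hAB i
    rw [h0, zero_mul, Nat.cast_zero] at h
    exact absurd h (not_le.2 hY)
  -- `a := 2 ^ s₀`, with `a ≤ |A i| < 2 a` on `I`
  obtain ⟨a, ha⟩ : ∃ a : ℕ, a = 2 ^ s₀ := ⟨_, rfl⟩
  have ha_le : ∀ i ∈ I, a ≤ (A i).card := by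
    intro i hi
    rw [ha, ← hmemI i hi, hs]
    exact Nat.pow_log_le_self 2 (hA0 i)
  have ha_lt : ∀ i ∈ I, (A i).card < 2 * a := by
    intro i hi
    rw [ha, ← hmemI i hi, hs, ← pow_succ']
    exact Nat.lt_pow_succ_log_self one_lt_two _
  -- `b := min_{i ∈ I} |B i|`
  obtain ⟨i₀, hi₀, hmin⟩ := exists_min_image I (fun i => (B i).card) hIne
  obtain ⟨b, hb⟩ : ∃ b : ℕ, b = (B i₀).card := ⟨_, rfl⟩
  have hb_le : ∀ i ∈ I, b ≤ (B i).card := fun i hi => hb ▸ hmin i hi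
  have hYab : Y ≤ 2 * ((a * b : ℕ) : ℝ) :=
    calc Y ≤ (((A i₀).card * (B i₀).card : ℕ) : ℝ) := hAB i₀
      _ ≤ ((2 * a * (B i₀).card : ℕ) : ℝ) := by
          exact_mod_cast Nat.mul_le_mul_right _ (ha_lt i₀ hi₀).le
      _ = 2 * ((a * b : ℕ) : ℝ) := by rw [hb]; push_cast; ring
  -- reindex along `Fin |I| ↪ Fin n` and shrink
  obtain ⟨e, he_inj, he_mem⟩ : ∃ e : Fin I.card → Fin n, Function.Injective e ∧ ∀ j, e j ∈ I :=
    ⟨fun j => (I.equivFin.symm j : Fin n), Subtype.val_injective.comp I.equivFin.symm.injective,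
      fun j => (I.equivFin.symm j).2⟩
  have hSe : IsSDPP (A ∘ e) (B ∘ e) := hS.reindex e he_inj
  choose A' hA'sub hA'card using fun j : Fin I.card => exists_subset_card_eq (ha_le (e j) (he_mem j))
  choose B' hB'sub hB'card using fun j : Fin I.card => exists_subset_card_eq (hb_le (e j) (he_mem j))
  refine ⟨I.card, a, b, A', B', hSe.mono hA'sub hB'sub, fun j => ⟨hA'card j, hB'card j⟩, hYab, ?_⟩
  rw [← hK]
  exact hI

/-- **The dyadic class count is sub-polynomial.**  If `p ≥ 1`, `1 ≤ x`, `0 < δ ≤ 1` and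
`p ≤ x^{2+δ}`, then `⌊log₂ p⌋ + 1 ≤ (6 / (δ log 2) + 1) · x^{δ/2}`: indeed
`⌊log₂ p⌋ · log 2 ≤ log p ≤ (2+δ) log x ≤ 3 log x ≤ 3 x^{δ/2} / (δ/2)` (`Real.log_le_rpow_div`) and
`1 ≤ x^{δ/2}`. [folklore] -/
theorem clusteredOfPrime_logBound {p : ℕ} (hp : p ≠ 0) {x δ : ℝ} (hx : 1 ≤ x) (hδ : 0 < δ)
    (hδ1 : δ ≤ 1) (hpx : (p : ℝ) ≤ x ^ (2 + δ)) :
    ((Nat.log 2 p + 1 : ℕ) : ℝ) ≤ (6 / (δ * Real.log 2) + 1) * x ^ (δ / 2) := by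
  have hx0 : 0 < x := one_pos.trans_le hx
  have hlog2 : 0 < Real.log 2 := Real.log_pos one_lt_two
  -- `2 ^ ⌊log₂ p⌋ ≤ p`
  have h1 : (2 : ℝ) ^ (Nat.log 2 p) ≤ p := by exact_mod_cast Nat.pow_log_le_self 2 hp
  -- `⌊log₂ p⌋ · log 2 ≤ (2 + δ) log x`
  have h2 : (Nat.log 2 p : ℝ) * Real.log 2 ≤ (2 + δ) * Real.log x := by
    rw [← Real.log_pow, ← Real.log_rpow hx0]
    exact Real.log_le_log (by positivity) (h1.trans hpx)
  have h3 : Real.log x ≤ x ^ (δ / 2) / (δ / 2) := Real.log_le_rpow_div hx0.le (by positivity)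
  have hlogx : 0 ≤ Real.log x := Real.log_nonneg hx
  have hxδ : 1 ≤ x ^ (δ / 2) := Real.one_le_rpow hx (by positivity)
  have h4 : (Nat.log 2 p : ℝ) * Real.log 2 ≤ 3 * (x ^ (δ / 2) / (δ / 2)) :=
    calc (Nat.log 2 p : ℝ) * Real.log 2 ≤ (2 + δ) * Real.log x := h2
      _ ≤ 3 * Real.log x := mul_le_mul_of_nonneg_right (by linarith) hlogx
      _ ≤ 3 * (x ^ (δ / 2) / (δ / 2)) := mul_le_mul_of_nonneg_left h3 (by norm_num)
  have hδ0 : δ ≠ 0 := hδ.ne'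
  have hl0 : Real.log 2 ≠ 0 := hlog2.ne'
  have h5 : (Nat.log 2 p : ℝ) ≤ 6 / (δ * Real.log 2) * x ^ (δ / 2) := by
    rw [← le_div_iff₀ hlog2] at h4
    calc (Nat.log 2 p : ℝ) ≤ 3 * (x ^ (δ / 2) / (δ / 2)) / Real.log 2 := h4
      _ = 6 / (δ * Real.log 2) * x ^ (δ / 2) := by
          field_simp
          ring
  have h6 : (6 / (δ * Real.log 2) + 1) * x ^ (δ / 2) =
      6 / (δ * Real.log 2) * x ^ (δ / 2) + x ^ (δ / 2) := by ring
  rw [h6]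
  push_cast
  linarith

/-- **`PrimeTwoFamilies` implies the clustered two-families leaf** (registered stub
`stub_clusteredOfPrimeTwoFamilies` of line `registered`; calibration: the birth line's open leaf,
CKSU Conj. 4.7 with prime cyclic hosts = item stmt-MatrixMultiplication-14308, taken as HYPOTHESIS,
implies the clustered-charts line's open leaf).  For every `ε > 0`: a prime `p`, an SDPP family
`(A_i, B_i)_{i<n}` in `ℤ/p` with `|A_i| = a`, `|B_i| = b`, `ab ≥ 2`, a class map
`cls : Fin n → Fin m` with cross-class disjoint difference sets `A_i − B_i`, classes of size `≥ d`,
and merit `m · d^{2/3} · (ab)^{(2+ε)/3} > p` — obtained with ONE class (`m = 1`, `d = n`) from the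
SDPP family of `PrimeTwoFamilies` at `δ := min ε 1 / 8` after uniformising the set sizes
(`clusteredOfPrime_uniformise`) and counting (`clusteredOfPrime_logBound`).
[cite: CohnKleinbergSzegedyUmans2005, §4 Conj. 4.7] -/
theorem stub_clusteredOfPrimeTwoFamilies :
    PrimeTwoFamilies →
    ∀ ε : ℝ, 0 < ε → ∃ p : ℕ, p.Prime ∧ ∃ (n m a b d : ℕ) (A B : Fin n → Finset (ZMod p))
      (cls : Fin n → Fin m), IsSDPP A B ∧ 2 ≤ a * b ∧ (∀ i, (A i).card = a ∧ (B i).card = b) ∧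
      (∀ i j, cls i ≠ cls j → Disjoint (A i - B i) (A j - B j)) ∧
      (∀ c : Fin m, d ≤ (Finset.univ.filter fun i => cls i = c).card) ∧
      (p : ℝ) < (m : ℝ) * (d : ℝ) ^ ((2 : ℝ) / 3) * ((a * b : ℕ) : ℝ) ^ ((2 + ε) / 3) := by
  intro hTF ε hε
  -- `ε₁ := min ε 1`
  obtain ⟨ε₁, hε₁, hε₁1, hε₁ε⟩ : ∃ ε₁ : ℝ, 0 < ε₁ ∧ ε₁ ≤ 1 ∧ ε₁ ≤ ε :=
    ⟨min ε 1, lt_min hε one_pos, min_le_right _ _, min_le_left _ _⟩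
  -- `δ := ε₁ / 8`, with the key exponent inequality
  obtain ⟨δ, hδ, hδ1, hkey⟩ : ∃ δ : ℝ, 0 < δ ∧ δ ≤ 1 ∧
      2 + δ + δ / 2 ≤ (1 - δ) * ((2 : ℝ) / 3) + (2 - δ) * ((2 + ε₁) / 3) := by
    refine ⟨ε₁ / 8, by positivity, by linarith, ?_⟩
    nlinarith [mul_le_of_le_one_right hε₁.le hε₁1]
  have hlog2 : 0 < Real.log 2 := Real.log_pos one_lt_two
  have hc0 : (0 : ℝ) ≤ 6 / (δ * Real.log 2) := by positivity
  -- the threshold: `6 / (δ log 2) + 3 ≤ n ^ (δ / 2)` eventually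
  obtain ⟨N₀, hN₀⟩ : ∃ N₀ : ℕ, ∀ n ≥ N₀, 6 / (δ * Real.log 2) + 3 ≤ (n : ℝ) ^ (δ / 2) := by
    have h := ((tendsto_rpow_atTop (by positivity : (0 : ℝ) < δ / 2)).comp
      tendsto_natCast_atTop_atTop).eventually
        (Filter.eventually_ge_atTop (6 / (δ * Real.log 2) + 3))
    obtain ⟨N₀, hN₀⟩ := Filter.eventually_atTop.1 h
    exact ⟨N₀, hN₀⟩
  -- the SDPP family of the hypothesis
  obtain ⟨n, hn, p, hp, A, B, hW, hX, hpn, hAB⟩ := hTF δ hδ (N₀ + 4)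
  haveI : NeZero p := ⟨hp.ne_zero⟩
  have hx4 : (4 : ℝ) ≤ n := by exact_mod_cast (show 4 ≤ n by omega)
  have hx1 : (1 : ℝ) ≤ n := by linarith
  have hx0 : (0 : ℝ) < n := by linarith
  have hC : 6 / (δ * Real.log 2) + 3 ≤ (n : ℝ) ^ (δ / 2) := hN₀ n (by omega)
  have hYpos : (0 : ℝ) < (n : ℝ) ^ (2 - δ) := Real.rpow_pos_of_pos hx0 _
  -- uniformise
  obtain ⟨n', a, b, A', B', hS', hcard, hYab, hI⟩ :=
    clusteredOfPrime_uniformise (by omega) (⟨hW, hX⟩ : IsSDPP A B) hYpos hAB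
  rw [ZMod.card p] at hI
  -- `K ≤ n ^ δ`
  have hKle : ((Nat.log 2 p + 1 : ℕ) : ℝ) ≤ (n : ℝ) ^ δ := by
    have h1 : 6 / (δ * Real.log 2) + 1 ≤ (n : ℝ) ^ (δ / 2) := by linarith
    have h2 : (0 : ℝ) ≤ (n : ℝ) ^ (δ / 2) := Real.rpow_nonneg hx0.le _
    calc ((Nat.log 2 p + 1 : ℕ) : ℝ) ≤ (6 / (δ * Real.log 2) + 1) * (n : ℝ) ^ (δ / 2) :=
          clusteredOfPrime_logBound hp.ne_zero hx1 hδ hδ1 hpn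
      _ ≤ (n : ℝ) ^ (δ / 2) * (n : ℝ) ^ (δ / 2) := mul_le_mul_of_nonneg_right h1 h2
      _ = (n : ℝ) ^ δ := by
          rw [← Real.rpow_add hx0]
          congr 1
          ring
  -- `n ^ (1 - δ) ≤ n'`
  have hn' : (n : ℝ) ^ (1 - δ) ≤ n' := by
    have hKpos : (0 : ℝ) < ((Nat.log 2 p + 1 : ℕ) : ℝ) := by positivity
    calc (n : ℝ) ^ (1 - δ) = n / (n : ℝ) ^ δ := by rw [Real.rpow_sub hx0, Real.rpow_one]
      _ ≤ n / ((Nat.log 2 p + 1 : ℕ) : ℝ) := div_le_div_of_nonneg_left hx0.le hKpos hKle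
      _ ≤ n' := hI
  -- `2 ≤ a b`
  have hxY : (n : ℝ) ≤ (n : ℝ) ^ (2 - δ) := by
    have h := Real.rpow_le_rpow_of_exponent_le hx1 (by linarith : (1 : ℝ) ≤ 2 - δ)
    rwa [Real.rpow_one] at h
  have h2ab : (2 : ℝ) ≤ ((a * b : ℕ) : ℝ) := by linarith
  have hab2 : 2 ≤ a * b := by exact_mod_cast h2ab
  have hab1 : (1 : ℝ) ≤ ((a * b : ℕ) : ℝ) := by linarith
  -- the witness: one class
  refine ⟨p, hp, n', 1, a, b, n', A', B', fun _ => 0, hS', hab2, hcard,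
    fun i j h => absurd rfl h, ?_, ?_⟩
  · intro c
    obtain rfl : c = 0 := Fin.fin_one_eq_zero c
    simp
  · -- the merit
    have hy0 : (0 : ℝ) ≤ ((a * b : ℕ) : ℝ) := Nat.cast_nonneg _
    have hE : (n : ℝ) ^ ((1 - δ) * ((2 : ℝ) / 3) + (2 - δ) * ((2 + ε₁) / 3)) =
        ((n : ℝ) ^ (1 - δ)) ^ ((2 : ℝ) / 3) * ((n : ℝ) ^ (2 - δ)) ^ ((2 + ε₁) / 3) := by
      rw [Real.rpow_add hx0, Real.rpow_mul hx0.le, Real.rpow_mul hx0.le]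
    have h1 : ((n : ℝ) ^ (1 - δ)) ^ ((2 : ℝ) / 3) ≤ (n' : ℝ) ^ ((2 : ℝ) / 3) :=
      Real.rpow_le_rpow (Real.rpow_nonneg hx0.le _) hn' (by norm_num)
    have h2 : ((n : ℝ) ^ (2 - δ)) ^ ((2 + ε₁) / 3) ≤
        2 * ((a * b : ℕ) : ℝ) ^ ((2 + ε₁) / 3) :=
      calc ((n : ℝ) ^ (2 - δ)) ^ ((2 + ε₁) / 3)
          ≤ (2 * ((a * b : ℕ) : ℝ)) ^ ((2 + ε₁) / 3) :=
            Real.rpow_le_rpow hYpos.le hYab (by positivity)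
        _ = (2 : ℝ) ^ ((2 + ε₁) / 3) * ((a * b : ℕ) : ℝ) ^ ((2 + ε₁) / 3) :=
            Real.mul_rpow (by norm_num) hy0
        _ ≤ (2 : ℝ) ^ (1 : ℝ) * ((a * b : ℕ) : ℝ) ^ ((2 + ε₁) / 3) :=
            mul_le_mul_of_nonneg_right
              (Real.rpow_le_rpow_of_exponent_le one_le_two (by linarith))
              (Real.rpow_nonneg hy0 _)
        _ = 2 * ((a * b : ℕ) : ℝ) ^ ((2 + ε₁) / 3) := by rw [Real.rpow_one]
    have h3 : ((a * b : ℕ) : ℝ) ^ ((2 + ε₁) / 3) ≤ ((a * b : ℕ) : ℝ) ^ ((2 + ε) / 3) :=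
      Real.rpow_le_rpow_of_exponent_le hab1 (by linarith)
    have hbig : 2 * (n : ℝ) ^ (2 + δ) <
        (n : ℝ) ^ ((1 - δ) * ((2 : ℝ) / 3) + (2 - δ) * ((2 + ε₁) / 3)) := by
      have h4 : (n : ℝ) ^ (2 + δ) * (n : ℝ) ^ (δ / 2) ≤
          (n : ℝ) ^ ((1 - δ) * ((2 : ℝ) / 3) + (2 - δ) * ((2 + ε₁) / 3)) := by
        rw [← Real.rpow_add hx0]
        exact Real.rpow_le_rpow_of_exponent_le hx1 hkey
      have h5 : (3 : ℝ) ≤ (n : ℝ) ^ (δ / 2) := by linarith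
      have h6 : (0 : ℝ) < (n : ℝ) ^ (2 + δ) := Real.rpow_pos_of_pos hx0 _
      calc 2 * (n : ℝ) ^ (2 + δ) < (n : ℝ) ^ (2 + δ) * 3 := by linarith
        _ ≤ (n : ℝ) ^ (2 + δ) * (n : ℝ) ^ (δ / 2) := mul_le_mul_of_nonneg_left h5 h6.le
        _ ≤ _ := h4
    have hprod : (n : ℝ) ^ ((1 - δ) * ((2 : ℝ) / 3) + (2 - δ) * ((2 + ε₁) / 3)) ≤
        2 * ((n' : ℝ) ^ ((2 : ℝ) / 3) * ((a * b : ℕ) : ℝ) ^ ((2 + ε) / 3)) := by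
      rw [hE]
      calc ((n : ℝ) ^ (1 - δ)) ^ ((2 : ℝ) / 3) * ((n : ℝ) ^ (2 - δ)) ^ ((2 + ε₁) / 3)
          ≤ (n' : ℝ) ^ ((2 : ℝ) / 3) * (2 * ((a * b : ℕ) : ℝ) ^ ((2 + ε₁) / 3)) :=
            mul_le_mul h1 h2 (Real.rpow_nonneg (Real.rpow_nonneg hx0.le _) _)
              (Real.rpow_nonneg (Nat.cast_nonneg _) _)
        _ ≤ (n' : ℝ) ^ ((2 : ℝ) / 3) * (2 * ((a * b : ℕ) : ℝ) ^ ((2 + ε) / 3)) :=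
            mul_le_mul_of_nonneg_left (by linarith) (Real.rpow_nonneg (Nat.cast_nonneg _) _)
        _ = 2 * ((n' : ℝ) ^ ((2 : ℝ) / 3) * ((a * b : ℕ) : ℝ) ^ ((2 + ε) / 3)) := by ring
    rw [Nat.cast_one, one_mul]
    linarith

end Summit.MatrixMultiplication.MatrixMultiplication.Theorems.HomocyclicSTPPDesigns.ClusteredCharts
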